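import Summits.Ventures.PercRepro.S1LowRankDownward

/-!
# PercRepro — THE LOW-RANK SETS COUNTED BY RANK (p2, gen 28; SUBCLAIM-S1 §6.10 (xvii)(q))

`#{k-sets of rank ≤ b + 1} = #{k-sets of rank ≤ b} + #{k-sets of rank b + 1}` and, when all pairs have rank `2`
and `k ≥ 2`, `{k-sets of rank ≤ 2} = rankTwoSets k`: the two identities that turn the up/down extension incidences
into inequalities between the `rkSets` counts of the rank profiles by sizes. Nothing is claimed about any cell.

* `ncard_lowRankSets_succ`, `lowRankSets_two_eq_rankTwoSets`, `ncard_lowRankSets_eq` (the closed form).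
Axioms: standard.
-/

open scoped Matroid

namespace PercRepro

namespace S1

open Set

variable {α : Type} {M : Matroid α} [M.Finite]

/-- `#low_k(≤ b + 1) = #low_k(≤ b) + #{k-sets of rank b + 1}`. -/
theorem ncard_lowRankSets_succ (k b : ℕ) :
    (lowRankSets M k (b + 1)).ncard = (lowRankSets M k b).ncard + (rkSets M k (b + 1)).ncard := by
  have heq : lowRankSets M k (b + 1) = lowRankSets M k b ∪ rkSets M k (b + 1) := by
    ext Q
    constructor
    · rintro ⟨hQE, hQk, hle⟩
      rcases lt_or_eq_of_le hle with hlt | heq'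
      · left
        refine ⟨hQE, hQk, ?_⟩
        have hfin : M.eRk Q ≠ ⊤ := ne_top_of_lt hlt
        obtain ⟨n, hn⟩ := ENat.ne_top_iff_exists.mp hfin
        rw [← hn] at hlt ⊢
        have : n < b + 1 := by exact_mod_cast hlt
        exact_mod_cast Nat.lt_succ_iff.mp this
      · right; exact ⟨hQE, hQk, heq'⟩
    · rintro (⟨hQE, hQk, hle⟩ | ⟨hQE, hQk, heq'⟩)
      · exact ⟨hQE, hQk, hle.trans (by exact_mod_cast Nat.le_succ b)⟩
      · exact ⟨hQE, hQk, le_of_eq heq'⟩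
  rw [heq, ncard_union_eq ?_ (lowRankSets_finite M k b) (rkSets_finite k (b + 1))]
  rw [Set.disjoint_left]
  rintro Q ⟨-, -, hle⟩ ⟨-, -, heq'⟩
  rw [heq'] at hle
  have : b + 1 ≤ b := by exact_mod_cast hle
  omega

/-- With all pairs of rank `2`, the `k`-sets (`k ≥ 2`) of rank `≤ 2` are exactly the rank-`2` `k`-sets. -/
theorem lowRankSets_two_eq_rankTwoSets (hpairs : ∀ e ∈ M.E, ∀ f ∈ M.E, e ≠ f → M.eRk {e, f} = 2) {k : ℕ}
    (hk : 2 ≤ k) : lowRankSets M k 2 = rankTwoSets M k := by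
  ext Q
  constructor
  · rintro ⟨hQE, hQk, hle⟩
    refine ⟨hQE, hQk, le_antisymm (by exact_mod_cast hle) ?_⟩
    have := two_le_eRk_of_two_le_ncard hpairs hQE (by omega)
    exact this
  · rintro ⟨hQE, hQk, h2⟩
    exact ⟨hQE, hQk, by rw [h2]; norm_num⟩

/-- The closed form: for `2 ≤ b` and `2 ≤ k`, `#low_k(≤ b) = t_k + Σ_{i < b − 2} #rkSets k (i + 3)`. -/
theorem ncard_lowRankSets_eq (hpairs : ∀ e ∈ M.E, ∀ f ∈ M.E, e ≠ f → M.eRk {e, f} = 2) {k : ℕ} (hk : 2 ≤ k)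
    (b : ℕ) (hb : 2 ≤ b) :
    (lowRankSets M k b).ncard = (rankTwoSets M k).ncard + ∑ i ∈ Finset.range (b - 2), (rkSets M k (i + 3)).ncard := by
  obtain ⟨c, rfl⟩ : ∃ c, b = c + 2 := ⟨b - 2, by omega⟩
  rw [Nat.add_sub_cancel]
  induction c with
  | zero => rw [lowRankSets_two_eq_rankTwoSets hpairs hk, Finset.sum_range_zero, add_zero]
  | succ c ih =>
    rw [show c + 1 + 2 = (c + 2) + 1 from rfl, ncard_lowRankSets_succ, ih (by omega), Finset.sum_range_succ,
      add_assoc, show c + 2 + 1 = c + 3 from rfl]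

end S1

end PercRepro
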